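import Summits.MatrixMultiplication.MatrixMultiplication.Theses.DeterminantalIdealExponent
import Literature.Computability.AlgebraicComplexity.DeterminantalIdealComplexity

/-!
# Crux `AndrewsLifting` (stmt-MatrixMultiplication-7709) — birth skeleton, line `birth` (BC3)

Route `route-MatrixMultiplication-DeterminantalIdealExponent`, crux (rank 2)

  `AndrewsLifting : ∀ r (g : ℂ[X_r]), g ≠ 0 →
     algBorderRank (matMulTensor ℂ (r/4) (r/4) (r/4)) ≤ 6 * complexity (g * detPoly (Fin r) ℂ)`

— Andrews 2022 (arXiv:2208.01078), Thm. 3 for `f = g · det_r ∈ I^det_{r,r,r}`, in the tree's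
division-free total-complexity currency.

The line is the PRINTED PROOF of Thm. 3, cut at its one natural seam, specialised to the route's
currency (`F = ℂ`, square format `n = m = r`, `f = g · det_r`):

* `stub_afStraightening` — Andrews–Forbes 2022 (arXiv:2112.00792) Prop. 3.5 for the nonzero ideal
  member `g · det_r`: a border-linear change of variables `ℓ = c • X` over `ℂ(ε)` turns `g · det_r`
  into `ε^q α (K_σ | K_σ)(X) + O(ε^{q+1})` with `α ≠ 0` and a part `σ₁ ≥ r` (bideterminant
  straightening; the commutative-algebra half).
* `stub_traceOracleLift` — Andrews' Lemma 8 (trace-ABP gadget) + Prop. 2 + Baur–Strassen (Lemma 2)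
  + Lemma 7 (`C̲_× ≤ R̲ ≤ 2 C̲_×`): from Prop.-3.5 data for ANY `f ∈ ℂ[X_r]` whose partition has a
  part `≥ 4t`, an order-`h` approximate decomposition of `⟨t,t,t⟩` with `≤ 6 · complexity f`
  triads, i.e. `algBorderRank (matMulTensor ℂ t t t) ≤ 6 * complexity f` (the circuit half).
* `AndrewsLifting_of_stubs` — the glue as an explicit implication
  `<stub₁ statement> → <stub₂ statement> → ∀ r g, g ≠ 0 → bR ≤ 6·complexity` (conclusion = the
  crux statement verbatim), a real proof: corner case `r < 4` (`⌊r/4⌋ = 0`, empty tensor, border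
  rank `0`); otherwise take the data of stub 1, `t := ⌊r/4⌋`, and the part `σ₁ ≥ r ≥ 4t` feeds
  stub 2.
* `AndrewsLifting_of : AndrewsLifting` — the REGISTERED skeleton theorem (A12 shape of
  `#h21_check_skeleton`: concludes the crux BY NAME, no hypotheses, `sorry` only inside the two
  declared stubs it applies `AndrewsLifting_of_stubs` to).

Imports are deliberately STATEMENT-LEVEL only (`…Theses.DeterminantalIdealExponent`,
`Literature…DeterminantalIdealComplexity` for `detIdeal`/`kBideterminant`/`IsBigOEps`): the proof
files `BideterminantReductionProofs` / `DeterminantalIdealComplexityProofs` are NOT imported, so the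
BC3 probes below test the stubs, not the library.

STATUS NOTE for the lead prover (2026-08-17): both stubs are DISCHARGED in Literature in their general
form — stub 1 ⇐ `AndrewsForbes2022_prop_3_5_holds` (BideterminantReductionProofs.lean) applied to
`mul_detPoly_mem_detIdeal` + `Matrix.det_mvPolynomialX_ne_zero`; stub 2 ⇐
`Andrews2022Proof.algBorderRank_le_of_prop35_data` (DeterminantalIdealComplexityProofs.lean) after
deriving its counting hypothesis `hN` from `∃ s ∈ σ, 4t ≤ s` (3 lines, as in
`Andrews2022_thm3_of_prop35`); and the crux itself is one line from the discharged fact: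
`fun r g hg => Andrews2022_thm3_holds.andrewsLifting r g hg`.
-/

-- the tree's namespace `Summit.MatrixMultiplication.MatrixMultiplication.…` repeats a component by design
set_option linter.dupNamespace false

noncomputable section

namespace Summit.MatrixMultiplication.MatrixMultiplication.Cruxes.AndrewsLifting.Birth

open MvPolynomial
open Literature.Computability.AlgebraicComplexity
open Summit.MatrixMultiplication.MatrixMultiplication.Theses.DeterminantalIdealExponent (AndrewsLifting)

/-- **Stub 1 — Andrews–Forbes straightening for multiples of `det_r` (AF22 Prop. 3.5 at `F = ℂ`,
`n = m = r`, `f = g · det_r`).** For `r ≥ 1` and `g ≠ 0` there are an `r² × r²` matrix `c` over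
`ℂ(ε)` (invertible: the border-linear forms `ℓ_{ij} = Σ c_{ij,kl} x_{kl}`), `q ∈ ℤ`, `α ≠ 0` and a
partition `σ` (parts in `[1, r]`, largest part `≥ r`, hence `= r`) with
`(g · det_r)(ℓ(X)) = ε^q α (K_σ | K_σ)(X) + O(ε^{q+1})` coefficientwise, `(K_σ|K_σ)` the product of
leading principal minors (`kBideterminant`). Why plausibly true: it is Prop. 3.5 of
Andrews–Forbes (STOC 2022) for the nonzero ideal member `g · det_r ∈ I^det_{r,r,r}`; proved via the
straightening law for bideterminants (DRS 1974 / DEP 1980) and an isolating weight `x_{ij} ↦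
ε^{d_{ij}} x_{ij}`. Size: L (the straightening law). Leans on: `detPoly`, `kBideterminant`,
`IsBigOEps` (tree), `RatFunc`, `Matrix.mvPolynomialX` (Mathlib).
[cite: AndrewsForbes2022, Prop. 3.5; Andrews2022, Prop. 1] -/
theorem stub_afStraightening :
    ∀ (r : ℕ) (g : MvPolynomial (Fin r × Fin r) ℂ), 0 < r → g ≠ 0 →
      ∃ (c : Matrix (Fin r × Fin r) (Fin r × Fin r) (RatFunc ℂ)) (q : ℤ) (α : ℂ) (σ : Multiset ℕ),
        IsUnit c ∧ α ≠ 0 ∧ r ≤ σ.sup ∧ (∀ s ∈ σ, 0 < s ∧ s ≤ r) ∧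
        ∀ e : (Fin r × Fin r) →₀ ℕ,
          IsBigOEps ℂ (q + 1) (MvPolynomial.coeff e
            (MvPolynomial.aeval
                (fun ij : Fin r × Fin r =>
                  ∑ kl : Fin r × Fin r, MvPolynomial.C (c ij kl) * MvPolynomial.X kl)
                (g * detPoly (Fin r) ℂ) -
              MvPolynomial.C (RatFunc.X ^ q * algebraMap ℂ (RatFunc ℂ) α) *
                MvPolynomial.map (algebraMap ℂ (RatFunc ℂ)) (kBideterminant ℂ r r σ))) := by
  sorry

/-- **Stub 2 — the trace-ABP oracle lift (Andrews 2022 Lemma 8 + Prop. 2 + Baur–Strassen +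
Lemma 7), square format over `ℂ`.** If `f ∈ ℂ[X_r]` straightens, under border-linear forms
`ℓ = c • X` over `ℂ(ε)`, to `ε^q α (K_σ|K_σ)(X) + O(ε^{q+1})` with `α ≠ 0`, all parts of `σ` at
most `r`, and SOME part `≥ 4t` (`t ≥ 1`), then `bR(⟨t,t,t⟩) ≤ 6 · complexity f`: substitute
Andrews' gadget matrix `M(X,Y,Z; ε)` (whose leading principal minors multiply to
`1 + ε tr(XYZ) + O(ε²)`, Lemma 8 with `N = 4t ≤ σ₁` vertices) into the circuit for `f` — affine
substitutions are free — to border-compute `tr(XYZ)` with `≤ complexity f` nonscalar steps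
(Prop. 2), take all `∂/∂z` by Baur–Strassen (`× 3`), read off `XY + O(ε)`, and pass from border
nonscalar complexity of the bilinear map to algebraic border rank (Lemma 7, `× 2`). Why plausibly
true: it is the printed proof of Thm. 3 (p. 11) below the straightening step. Size: L (gadget
determinant expansion over `ℂ((ε))`, Baur–Strassen for nonscalar sequences, Lemma 7). Leans on:
`algBorderRank`, `matMulTensor`, `complexity`, `kBideterminant`, `IsBigOEps` (tree).
[cite: Andrews2022, Lemma 7, Lemma 8, Prop. 2, Thm. 3 (proof); BaurStrassen1983] -/
theorem stub_traceOracleLift :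
    ∀ (r t : ℕ) (f : MvPolynomial (Fin r × Fin r) ℂ)
      (c : Matrix (Fin r × Fin r) (Fin r × Fin r) (RatFunc ℂ)) (q : ℤ) (α : ℂ) (σ : Multiset ℕ),
      α ≠ 0 → 0 < t → (∀ s ∈ σ, s ≤ r) → (∃ s ∈ σ, 4 * t ≤ s) →
      (∀ e : (Fin r × Fin r) →₀ ℕ,
          IsBigOEps ℂ (q + 1) (MvPolynomial.coeff e
            (MvPolynomial.aeval
                (fun ij : Fin r × Fin r =>
                  ∑ kl : Fin r × Fin r, MvPolynomial.C (c ij kl) * MvPolynomial.X kl) f -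
              MvPolynomial.C (RatFunc.X ^ q * algebraMap ℂ (RatFunc ℂ) α) *
                MvPolynomial.map (algebraMap ℂ (RatFunc ℂ)) (kBideterminant ℂ r r σ)))) →
      algBorderRank (matMulTensor ℂ t t t) ≤ 6 * complexity f := by
  sorry

/-- **Composition with explicit hypotheses (kernel-checked): stub 1 → stub 2 → the crux statement**
(the conclusion is the body of `AndrewsLifting` verbatim, so that only `AndrewsLifting_of` below
concludes the crux by name). Corner case `r < 4`:
`⌊r/4⌋ = 0` and `bR` of the empty tensor `⟨0,0,0⟩` is `0` (`algBorderRank ≤ tensorRank ≤ 0·0·0`).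
Main case `r ≥ 4`: stub 1 for `g · det_r` gives `c, q, α, σ` with `σ.sup ≥ r`; since
`4⌊r/4⌋ ≤ r` some part of `σ` is `≥ 4t` for `t = ⌊r/4⌋ ≥ 1`, and stub 2 with `f = g · det_r`
concludes. [cite: Andrews2022, Thm. 3] -/
theorem AndrewsLifting_of_stubs :
    (∀ (r : ℕ) (g : MvPolynomial (Fin r × Fin r) ℂ), 0 < r → g ≠ 0 →
      ∃ (c : Matrix (Fin r × Fin r) (Fin r × Fin r) (RatFunc ℂ)) (q : ℤ) (α : ℂ) (σ : Multiset ℕ),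
        IsUnit c ∧ α ≠ 0 ∧ r ≤ σ.sup ∧ (∀ s ∈ σ, 0 < s ∧ s ≤ r) ∧
        ∀ e : (Fin r × Fin r) →₀ ℕ,
          IsBigOEps ℂ (q + 1) (MvPolynomial.coeff e
            (MvPolynomial.aeval
                (fun ij : Fin r × Fin r =>
                  ∑ kl : Fin r × Fin r, MvPolynomial.C (c ij kl) * MvPolynomial.X kl)
                (g * detPoly (Fin r) ℂ) -
              MvPolynomial.C (RatFunc.X ^ q * algebraMap ℂ (RatFunc ℂ) α) *
                MvPolynomial.map (algebraMap ℂ (RatFunc ℂ)) (kBideterminant ℂ r r σ)))) →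
    (∀ (r t : ℕ) (f : MvPolynomial (Fin r × Fin r) ℂ)
      (c : Matrix (Fin r × Fin r) (Fin r × Fin r) (RatFunc ℂ)) (q : ℤ) (α : ℂ) (σ : Multiset ℕ),
      α ≠ 0 → 0 < t → (∀ s ∈ σ, s ≤ r) → (∃ s ∈ σ, 4 * t ≤ s) →
      (∀ e : (Fin r × Fin r) →₀ ℕ,
          IsBigOEps ℂ (q + 1) (MvPolynomial.coeff e
            (MvPolynomial.aeval
                (fun ij : Fin r × Fin r =>
                  ∑ kl : Fin r × Fin r, MvPolynomial.C (c ij kl) * MvPolynomial.X kl) f -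
              MvPolynomial.C (RatFunc.X ^ q * algebraMap ℂ (RatFunc ℂ) α) *
                MvPolynomial.map (algebraMap ℂ (RatFunc ℂ)) (kBideterminant ℂ r r σ)))) →
      algBorderRank (matMulTensor ℂ t t t) ≤ 6 * complexity f) →
    ∀ (r : ℕ) (g : MvPolynomial (Fin r × Fin r) ℂ), g ≠ 0 →
      algBorderRank (matMulTensor ℂ (r / 4) (r / 4) (r / 4)) ≤
        6 * complexity (g * detPoly (Fin r) ℂ) := by
  intro h1 h2 r g hg
  by_cases hr : r < 4
  · -- corner case: `⌊r/4⌋ = 0`, the tensor `⟨0,0,0⟩` is empty and has border rank `0`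
    have ht0 : r / 4 = 0 := Nat.div_eq_of_lt hr
    rw [ht0]
    have h0 : algBorderRank (matMulTensor ℂ 0 0 0) ≤ 0 :=
      (algBorderRank_le_tensorRank _).trans
        ((tensorRank_matMulTensor_le (K := ℂ) 0 0 0).trans (le_of_eq (by norm_num)))
    exact h0.trans (Nat.zero_le _)
  · -- main case `4 ≤ r`: straighten `g · det_r`, then lift with `t = ⌊r/4⌋`
    push Not at hr
    obtain ⟨c, q, α, σ, -, hα, hsup, hσ, hcoef⟩ := h1 r g (by omega) hg
    have hbig : ∃ s ∈ σ, 4 * (r / 4) ≤ s := by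
      by_contra hcon
      push Not at hcon
      have hle : σ.sup ≤ 4 * (r / 4) - 1 :=
        Multiset.sup_le.2 fun s hs => Nat.le_sub_one_of_lt (hcon s hs)
      omega
    exact h2 r (r / 4) (g * detPoly (Fin r) ℂ) c q α σ hα (by omega) (fun s hs => (hσ s hs).2)
      hbig hcoef

/-- **The registered skeleton theorem: `AndrewsLifting` from the two declared stubs.** Concludes
the route crux `Summit.MatrixMultiplication.MatrixMultiplication.Theses.DeterminantalIdealExponent.AndrewsLifting`
BY NAME with no hypotheses; its only `sorry`s are inside `stub_afStraightening` and
`stub_traceOracleLift` (closing both stubs closes the crux). [cite: Andrews2022, Thm. 3] -/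
theorem AndrewsLifting_of : AndrewsLifting :=
  AndrewsLifting_of_stubs stub_afStraightening stub_traceOracleLift

end Summit.MatrixMultiplication.MatrixMultiplication.Cruxes.AndrewsLifting.Birth

end
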